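import Summits.BirchSwinnertonDyer.BirchSwinnertonDyer.Theorems.PrintX10bStubAExactAtPAnnSatHolds
import Summits.BirchSwinnertonDyer.BirchSwinnertonDyer.Theorems.PrintX10bStubAExactRepAtP
import HarnessLib

/-!
# STUB A of the shared μ-item CLOSED: `stub_exactAtP : Stmt.exactAtP` ((Exact) at `v ∣ p`) — the registered stub of skeleton v8
# of `MuInequalityCoherentPairOfPrintCG` (stmt-BirchSwinnertonDyer-23428), by name (D1 custodian, x10b-p1 LEAD g9)

The registered stub `stub_exactAtP : Stmt.exactAtP` of skeleton v8 (sha16 d92afa7d068a800a) of the shared deciding μ-crux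
`Summit.BirchSwinnertonDyer.BirchSwinnertonDyer.Theses.PrintX9.MuInequalityCoherentPairOfPrintCG` (stmt-BirchSwinnertonDyer-23428;
X10b twin of record stmt-BirchSwinnertonDyer-23055 closes from it by name), in the letter's own namespace
`…Theorems.HeegnerMuPartH4AtS` (letter `Stmt.exactAtP` = D1 v3, `Theorems/PrintX10bStubAH4AtSOfExactAtP`, p672535).
Composition of three landed pieces: the D1 split `exactAtP_of_exactRep_of_annSat : Stmt.exactRepAtP → Stmt.annSatAtP → Stmt.exactAtP`
(`Theorems/PrintX10bStubAExactAtPOfClauses`, p673458); the (ANN-SAT) half `annSatAtP_holds` (x9-p1-w4, `Theorems/PrintX10bStubAExactAtPAnnSatHolds`,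
p674099, over `ZpExtensionEisensteinDVRSettingH4AnnSat*Proofs`); and the (EXACT-REP) half `exactRepAtP_holds` (x9-p1-w4 g9 frame term
`Theorems/PrintX10bStubAExactRepAtP` over x9-p1-w2's instances `ZpExtensionEisensteinDVRSettingH4ExactRep[Left]Proofs` of the generic
`Tower.exists_sub_pow_smul_forall_pairing_eq_zero`).  Mathematically: Howard's hypothesis H.4 for the Selmer structure `F_𝔮` of the
curve's Eisenstein tower at the places `v ∣ p` — the saturated strict-ordinary local conditions are their own exact orthogonal
complements under the Weil–τ cup product, in the limit (rank-free proof of the cell memo `HOME/p1/H4-EXACT-AT-P-PLAN-x10b-p1-g8.md` §1).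
HONEST FRAMING: conditional on nothing beyond the tree (the Poitou–Tate duality for Selmer structures is a theorem of the tree); this closes
ONE registered stub of ONE crux; the crux itself still needs `stub_h5bAtSZeroP` and `stub_readoutIndex`; no summit statement is proved;
BSD is not proved by any of this.
-/

set_option linter.dupNamespace false
set_option autoImplicit false

namespace Summit.BirchSwinnertonDyer.BirchSwinnertonDyer.Theorems.HeegnerMuPartH4AtS

/-- **STUB A, registered stub `stub_exactAtP` of skeleton v8 of the shared μ-crux (stmt-BirchSwinnertonDyer-23428): (Exact) at the
places `v ∣ p` for Howard's H.4 on `F_𝔮`** — by name from the (EXACT-REP) frame term `exactRepAtP_holds` and the (ANN-SAT) frame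
term `annSatAtP_holds` through the D1 composition `exactAtP_of_exactRep_of_annSat`. -/
theorem stub_exactAtP : Stmt.exactAtP :=
  exactAtP_of_exactRep_of_annSat exactRepAtP_holds annSatAtP_holds

end Summit.BirchSwinnertonDyer.BirchSwinnertonDyer.Theorems.HeegnerMuPartH4AtS
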